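import Literature.Probability.RandomPlanarGeometry.SLEBubblesAssembly
import Literature.Probability.RandomPlanarGeometry.SLEKappaRhoAssembly
import Literature.Probability.RandomPlanarGeometry.SLEKappaRhoBesselEquation
import Literature.Probability.RandomPlanarGeometry.SLEKappaRhoDriving
import HarnessLib

/-!
# [LSW] p. 5 result 2 (`eq_five_eighths_of_outer_simple`): the finiteness leaf of §8.3 discharged, and the assembly from the ten remaining printed leaves

Assembly file for the named facts
`Literature.Probability.RandomPlanarGeometry.IsRestrictionMeasure.eq_five_eighths_of_outer_simple`
and `…eq_five_eighths_of_simple` (`RestrictionMeasures`; plan in `RestrictionMeasuresFiveEighths`,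
proved second halves in `RestrictionLeftFillLaw`, `RestrictionExponentHalf`,
`OneSidedRestrictionFacts`; the §7 side in `SLEBubbles`, `SLEBubblesAssembly`; the §8 side in
`SLEKappaRho`, `SLEKappaRhoRestriction(Proofs)`, `SLEKappaRhoFillVersion`, `SLEKappaRhoAssembly`,
`SLEKappaRhoAsymmetry`, `SLEKappaRhoDriving`), after

* G. F. Lawler, O. Schramm, W. Werner, *Conformal restriction: the chordal case*, J. Amer. Math.
  Soc. **16** (2003) 917–955, arXiv:math/0209343 (**[LSW]**), p. 5 result 2 ("The only measure
  `P_α` that is supported on simple curves is `P_{5/8}`"), obtained in the paper from Cor. 8.6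
  (p. 37: "For all `α < 5/8`, the two-sided restriction probability measure `P_α` does not
  exist", proved from Thm. 8.4 and the asymmetry of SLE(8/3, ρ), `ρ < 0`, p. 38) and Thm. 7.3
  (p. 29: `P_α`, `α > 5/8`, is SLE_κ plus a Poisson cloud of Brownian bubbles); §8.3 (p. 36):
  "Note also that `∫₀ᵗ du/Z_u = (Z_t − √κ B_t)/(ρ + 2) < ∞` for all `t ≥ 0`."

Contents (no new named fact; everything PROVED):

* `Literature.Probability.RandomPlanarGeometry.SLEKappaRho.intervalIntegrable_inv_holds` —
  DISCHARGE of the named fact `SLEKappaRho.intervalIntegrable_inv` (`SLEKappaRhoAssembly`: a.s.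
  `u ↦ 1/Z_u` is integrable on every `[0, t]` for an SLE(κ, ρ) driving pair, `κ > 0`, `ρ > −2`),
  from the tree's proof of the full displayed sentence of §8.3
  (`SLEKappaRho.integral_inv_eq_holds`, `SLEKappaRhoBesselEquation`, itself from the Bessel
  stochastic differential equation for `BES^d(0)`, `d > 1`) through
  `SLEKappaRho.intervalIntegrable_inv_of`;
* [LSW] Thm. 8.4 from FOUR leaves (`SLEKappaRho.isRightRestrictionMeasure_fill_of_four_leaves`,
  with its two halves `…exists_measurable_fill_version_of_four_leaves`,
  `…measure_fill_disjoint_of_four_leaves`): the tree's weak-leaf assembly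
  (`SLEKappaRho.isRightRestrictionMeasure_fill_of_weak_leaves`) with the finiteness leaf fed by
  the discharge — remaining: the martingale of Lemmas 8.9–8.10
  (`SLEKappaRho.exists_isOneSidedMartingale`), Lemma 6.2 (`Loewner.restrictionDeriv_exitTime_gt`),
  Lemma 6.3 (`IsSmoothHull.restrictionDerivVanishesAtHit`) and Lemma 8.3 (2) on the positive
  axis (`SLEKappaRho.swallowingTime_ofReal_pos`);
* the asymmetry `SLEKappaRho.one_half_lt_measure_I_notMem_fill` from its TWO printed sentences
  (`SLEKappaRho.one_half_lt_measure_I_notMem_fill_of_two_leaves`): the symmetry sentence for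
  SLE_{8/3} (`measure_I_notMem_leftFilling_sle_eq_half`) and the comparison sentence
  (`SLEKappaRho.measure_I_notMem_fill_lt_of_neg`), the Bessel identity being proved;
* hence [LSW] Cor. 8.6 (`not_exists_isRestrictionMeasure_of_lt_five_eighths_of_six_leaves`) from
  the six §6/§8 leaves, and **p. 5 result 2 in both readings from the ten remaining leaves**
  (`IsRestrictionMeasure.eq_five_eighths_of_outer_simple_of_ten_leaves`,
  `IsRestrictionMeasure.eq_five_eighths_of_simple_of_ten_leaves`): the six above and, on the
  §7 side, a Brownian bubble measure with interior points
  (`exists_isBrownianBubbleMeasure_ae_interior_nonempty`, §7.1), Kingman's existence theorem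
  (`Literature.Probability.Process.exists_isPoissonCloud`), and the two halves of Thm. 7.3
  (`SLEBubbles.exists_measurable_version`, `SLEBubbles.measure_disjoint`).

So the discharge `IsRestrictionMeasure.eq_five_eighths_of_outer_simple_holds` is exactly
`…_of_ten_leaves` applied to the ten `_holds` theorems of these named facts, once they exist.

Mathlib: none beyond the imports. Tree: the assemblies quoted above.
-/

noncomputable section

open scoped NNReal ENNReal
open Literature.Probability.Process (exists_isPoissonCloud)

namespace Literature.Probability.RandomPlanarGeometry

/-! ### The finiteness leaf of §8.3, discharged -/

/-- **DISCHARGE of `SLEKappaRho.intervalIntegrable_inv`** ([LSW] §8.3, p. 36: "`∫₀ᵗ du/Z_u =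
(Z_t − √κ B_t)/(ρ + 2) < ∞` for all `t ≥ 0`", the finiteness half): almost surely, for every
`t`, `u ↦ 1/Z_u` is integrable on `[0, t]` — the first conjunct of the proved identity
`SLEKappaRho.integral_inv_eq_holds`. [cite: LawlerSchrammWerner2003Restriction, §8.3 (definition of SLE(κ, ρ): ∫₀ᵗ du/Z_u < ∞ for all t ≥ 0, p. 36)] -/
theorem SLEKappaRho.intervalIntegrable_inv_holds : SLEKappaRho.intervalIntegrable_inv :=
  SLEKappaRho.intervalIntegrable_inv_of SLEKappaRho.integral_inv_eq_holds

/-! ### [LSW] Theorem 8.4 from four leaves -/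

/-- **`K = F^{ℝ₊}_ℍ(cl K_∞)` of SLE(8/3, ρ) is a random element of `Ω₊`, from four leaves**: the
martingale of Lemmas 8.9–8.10, Lemma 6.2, Lemma 6.3 and Lemma 8.3 (2) on the positive axis (the
finiteness `∫₀ᵗ du/Z_u < ∞` of §8.3 being proved).
[cite: LawlerSchrammWerner2003Restriction, Thm. 8.4 (p. 37) with §8.1 (p. 31), Lemma 8.3 (p. 36), §8.3 (p. 36)] -/
theorem SLEKappaRho.exists_measurable_fill_version_of_four_leaves
    (hM : SLEKappaRho.exists_isOneSidedMartingale)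
    (h62 : Loewner.restrictionDeriv_exitTime_gt) (h63 : IsSmoothHull.restrictionDerivVanishesAtHit)
    (h83 : SLEKappaRho.swallowingTime_ofReal_pos) : SLEKappaRho.exists_measurable_fill_version :=
  SLEKappaRho.exists_measurable_fill_version_of_weak_leaves SLEKappaRho.intervalIntegrable_inv_holds
    hM h62 h63 h83

/-- **The avoidance formula of Thm. 8.4, `P[F^{ℝ₊}_ℍ(cl K_∞) ∩ A = ∅] = Φ_A'(0)^α` for
`A ∈ 𝒬₊`, from four leaves** (as above). [cite: LawlerSchrammWerner2003Restriction, Thm. 8.4 (p. 37) and its proof (§8.4)] -/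
theorem SLEKappaRho.measure_fill_disjoint_of_four_leaves
    (hM : SLEKappaRho.exists_isOneSidedMartingale)
    (h62 : Loewner.restrictionDeriv_exitTime_gt) (h63 : IsSmoothHull.restrictionDerivVanishesAtHit)
    (h83 : SLEKappaRho.swallowingTime_ofReal_pos) : SLEKappaRho.measure_fill_disjoint :=
  SLEKappaRho.measure_fill_disjoint_of_weak_leaves SLEKappaRho.intervalIntegrable_inv_holds
    hM h62 h63 h83

/-- **[LSW] Theorem 8.4 in law form from four leaves**: the law of the `Ω₊`-valued version of
`K = F^{ℝ₊}_ℍ(cl K_∞)` for SLE(8/3, ρ), `ρ > −2`, is `P⁺_{α(ρ)}`, `α(ρ) = (3ρ + 10)(2 + ρ)/32`,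
given the martingale of Lemmas 8.9–8.10 (`hM`), Lemma 6.2 (`h62`), Lemma 6.3 (`h63`) and
Lemma 8.3 (2) on the positive axis (`h83`). [cite: LawlerSchrammWerner2003Restriction, Thm. 8.4 (p. 37) and its proof (§8.4)] -/
theorem SLEKappaRho.isRightRestrictionMeasure_fill_of_four_leaves
    (hM : SLEKappaRho.exists_isOneSidedMartingale)
    (h62 : Loewner.restrictionDeriv_exitTime_gt) (h63 : IsSmoothHull.restrictionDerivVanishesAtHit)
    (h83 : SLEKappaRho.swallowingTime_ofReal_pos) : SLEKappaRho.isRightRestrictionMeasure_fill :=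
  SLEKappaRho.isRightRestrictionMeasure_fill_of_weak_leaves SLEKappaRho.intervalIntegrable_inv_holds
    hM h62 h63 h83

/-! ### The asymmetry of SLE(8/3, ρ), `ρ < 0`, from its two printed sentences -/

/-- **`P{i ∉ F^{ℝ₊}_ℍ(cl K_∞)} > 1/2` for SLE(8/3, ρ), `−2 < ρ < 0`, from the two sentences of
[LSW] p. 38**: the symmetry sentence for SLE_{8/3} (`h₀`) and the comparison with SLE(8/3, 0)
(`hlt`); the Bessel identity of §8.3 relating SLE(8/3, 0) pairs to `√κ B` is proved
(`SLEKappaRho.integral_inv_eq_holds`).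
[cite: LawlerSchrammWerner2003Restriction, proof of Cor. 8.6 (p. 38), first two sentences, with §8.3] -/
theorem SLEKappaRho.one_half_lt_measure_I_notMem_fill_of_two_leaves
    (h₀ : measure_I_notMem_leftFilling_sle_eq_half)
    (hlt : SLEKappaRho.measure_I_notMem_fill_lt_of_neg) :
    SLEKappaRho.one_half_lt_measure_I_notMem_fill :=
  SLEKappaRho.one_half_lt_measure_I_notMem_fill_of_leaves SLEKappaRho.integral_inv_eq_holds h₀ hlt

/-! ### [LSW] Corollary 8.6 and p. 5 result 2 from the remaining leaves -/

/-- **[LSW] Corollary 8.6 from six leaves** ("For all `α < 5/8`, the two-sided restriction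
probability measure `P_α` does not exist"): Thm. 8.4 from `hM`, `h62`, `h63`, `h83`, the
asymmetry from `h₀`, `hlt`, and the proved second half of the printed proof
(`not_exists_isRestrictionMeasure_of_lt_five_eighths_of_sleKappaRho`).
[cite: LawlerSchrammWerner2003Restriction, Cor. 8.6 (pp. 37–38)] -/
theorem not_exists_isRestrictionMeasure_of_lt_five_eighths_of_six_leaves
    (hM : SLEKappaRho.exists_isOneSidedMartingale)
    (h62 : Loewner.restrictionDeriv_exitTime_gt) (h63 : IsSmoothHull.restrictionDerivVanishesAtHit)
    (h83 : SLEKappaRho.swallowingTime_ofReal_pos)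
    (h₀ : measure_I_notMem_leftFilling_sle_eq_half)
    (hlt : SLEKappaRho.measure_I_notMem_fill_lt_of_neg) :
    not_exists_isRestrictionMeasure_of_lt_five_eighths :=
  not_exists_isRestrictionMeasure_of_lt_five_eighths_of_sleKappaRho
    (SLEKappaRho.isRightRestrictionMeasure_fill_of_four_leaves hM h62 h63 h83)
    (SLEKappaRho.one_half_lt_measure_I_notMem_fill_of_two_leaves h₀ hlt)

/-- **[LSW] p. 5 result 2, outer reading, from the ten remaining leaves**
(`IsRestrictionMeasure.eq_five_eighths_of_outer_simple`: a two-sided restriction measure `P_α`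
carried — as an outer measure — by simple paths has `α = 5/8`). §6/§8 side: the martingale of
Lemmas 8.9–8.10 (`hM`), Lemma 6.2 (`h62`), Lemma 6.3 (`h63`), Lemma 8.3 (2) on `(0, ∞)` (`h83`),
the symmetry sentence for SLE_{8/3} (`h₀`) and the comparison sentence (`hlt`) of p. 38. §7
side: a Brownian bubble measure with interior points (`hμex`, §7.1), Kingman's existence theorem
(`hK`), and Thm. 7.3 as the measurable version (`h₁`) and the avoidance formula (`h₂`) of `Ξ(κ)`.
Everything else — [LSW] Prop. 3.3 (uniqueness), Remark 3.7, §8.1 (`F^{ℝ₊}_ℍ(P_α) = P⁺_α`), the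
symmetry bound `P_α(i right of K) ≤ 1/2`, the semigroup of one-sided measures, Lemma 8.3 (4),
§8.3's Bessel identity, Kolmogorov's extension — is proved in the tree.
[cite: LawlerSchrammWerner2003Restriction, p. 5 result 2; Thm. 7.3 (p. 29), Thm. 8.4 (p. 37), Cor. 8.6 (pp. 37–38)] -/
theorem IsRestrictionMeasure.eq_five_eighths_of_outer_simple_of_ten_leaves
    (hM : SLEKappaRho.exists_isOneSidedMartingale)
    (h62 : Loewner.restrictionDeriv_exitTime_gt) (h63 : IsSmoothHull.restrictionDerivVanishesAtHit)
    (h83 : SLEKappaRho.swallowingTime_ofReal_pos)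
    (h₀ : measure_I_notMem_leftFilling_sle_eq_half)
    (hlt : SLEKappaRho.measure_I_notMem_fill_lt_of_neg)
    (hμex : exists_isBrownianBubbleMeasure_ae_interior_nonempty) (hK : exists_isPoissonCloud.{0})
    (h₁ : SLEBubbles.exists_measurable_version) (h₂ : SLEBubbles.measure_disjoint) :
    IsRestrictionMeasure.eq_five_eighths_of_outer_simple :=
  IsRestrictionMeasure.eq_five_eighths_of_outer_simple_of_bubbles' hμex hK h₁ h₂
    (SLEKappaRho.exists_measurable_fill_version_of_four_leaves hM h62 h63 h83)
    (SLEKappaRho.measure_fill_disjoint_of_four_leaves hM h62 h63 h83)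
    (SLEKappaRho.one_half_lt_measure_I_notMem_fill_of_two_leaves h₀ hlt)

/-- **[LSW] p. 5 result 2, almost-everywhere reading, from the same ten leaves**
(`IsRestrictionMeasure.eq_five_eighths_of_simple`).
[cite: LawlerSchrammWerner2003Restriction, p. 5 result 2; Thm. 7.3 (p. 29), Thm. 8.4 (p. 37), Cor. 8.6 (pp. 37–38)] -/
theorem IsRestrictionMeasure.eq_five_eighths_of_simple_of_ten_leaves
    (hM : SLEKappaRho.exists_isOneSidedMartingale)
    (h62 : Loewner.restrictionDeriv_exitTime_gt) (h63 : IsSmoothHull.restrictionDerivVanishesAtHit)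
    (h83 : SLEKappaRho.swallowingTime_ofReal_pos)
    (h₀ : measure_I_notMem_leftFilling_sle_eq_half)
    (hlt : SLEKappaRho.measure_I_notMem_fill_lt_of_neg)
    (hμex : exists_isBrownianBubbleMeasure_ae_interior_nonempty) (hK : exists_isPoissonCloud.{0})
    (h₁ : SLEBubbles.exists_measurable_version) (h₂ : SLEBubbles.measure_disjoint) :
    IsRestrictionMeasure.eq_five_eighths_of_simple :=
  IsRestrictionMeasure.eq_five_eighths_of_simple_of_outer
    (IsRestrictionMeasure.eq_five_eighths_of_outer_simple_of_ten_leaves hM h62 h63 h83 h₀ hlt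
      hμex hK h₁ h₂)

end Literature.Probability.RandomPlanarGeometry

end
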